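import Mathlib
import Literature.NumberTheory.LFunctions.MoebiusAutomatic
import Literature.NumberTheory.LFunctions.AutomaticSequenceAutomata
import Summits.QuantumAdvantage.QuantumAdvantage.Theorems.MobiusLadderDigitPolyUniformityLiouvilleAutomatic
import Literature.Probability.RandomGraphs.LowDegree
import HarnessLib

/-!
# Crux `MobiusLadder.LiouvilleOrthogonalTC0` (stmt-QuantumAdvantage-1393), line `Sketch`, skeleton v9:
stub `stub_automaticFamily` (A1) — `λ` is orthogonal to every `S`-state automaton, uniformly

Assuming the named fact `mullner_moebius_automatic` (Müllner 2017, Thm. 1.2: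
`∑_{n ≤ N} a(n) μ(n) = o(N)` for every `k`-automatic `a`, `k ≥ 2`), for every number of states `S`
and every `ε > 0` there is ONE threshold `N₀` such that for all `N ≥ N₀` and ALL automata
`(δ, q₀, τ)` on the state set `Fin S` — transition map `δ : Fin S → ℕ → Fin S` (fed binary
digits), start `q₀`, Boolean output `τ` — reading the binary digits of `m` either from the most
significant one (`(Nat.digits 2 m).reverse`, the tree's `dfaoSeq 2`) or from the least significant
one (`Nat.digits 2 m`), `|∑_{m ≤ N} λ(m) · sgn τ(state of m)| ≤ ε N`.

Proof. Each such `±1`-sequence is `2`-automatic: MSB-first it is literally a `dfaoSeq`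
(`isAutomaticSeq_dfaoSeq`, Allouche–Shallit Thm. 6.6.2 "⇒"); LSB-first, the kernel element
`(a(2ⁱ n + r))ₙ` is the same automaton started at the state reached after the zero-padded digits
of `r` (`digits_add_pow_mul`), up to its value at `n = 0`
(`automaticFamily_isAutomaticSeq_foldl`). So the `λ`-form of Müllner's theorem
(`MobiusLadder.liouville_automatic_of_mullner`, from `λ = 𝟙_□ ⋆ μ`) bounds each sum for
`N ≥ N₀(δ, q₀, τ)` (`automaticFamily_bound`; the real and the complex sum are compared by
`automaticFamily_abs_sum_eq_norm`). Uniformity: the digits of `m` are `0, 1`, so the state depends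
on `δ` only through the finite table `(q, b) ↦ δ q b`, `b < 2` (`automaticFamily_foldl_congr`);
the family is thus indexed by the FINITE type `(Fin S → Fin 2 → Fin S) × Fin S × (Fin S → Bool)`,
and `N₀` is a common upper bound of the thresholds over it (`Finite.exists_le`).
-/

set_option linter.dupNamespace false -- D-0017: single-problem summit ⇒ `QuantumAdvantage.QuantumAdvantage` by design

noncomputable section

namespace Summit.QuantumAdvantage.QuantumAdvantage.Theorems.LiouvilleOrthogonalTC0

open Literature.Probability.RandomGraphs.LowDegree (sgn)
open Literature.NumberTheory.LFunctions (IsAutomaticSeq dfaoSeq isAutomaticSeq_dfaoSeq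
  digits_add_pow_mul mullner_moebius_automatic)
open Summit.QuantumAdvantage.QuantumAdvantage.Theorems.MobiusLadder (liouville_automatic_of_mullner)

/-- **LSB-first automata generate automatic sequences.** For a finite state set `σ`, `k ≥ 2`, a
transition map `δ`, a start `q₀` and an output `τ`, the sequence `n ↦ τ(δ*(q₀, digits of n))`
reading the base-`k` digits from the LEAST significant one has finite `k`-kernel: for `n ≥ 1` the
digits of `kⁱ n + r` (`r < kⁱ`) are the zero-padded digits of `r` followed by those of `n`
(`digits_add_pow_mul`), so the kernel element `(a(kⁱ n + r))ₙ` is the same automaton started at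
`δ*(q₀, padded digits of r)`, except for its value `a(r)` at `n = 0`; hence the kernel lies in the
image of the finite set `σ × range τ` (Allouche–Shallit Thm. 6.6.2 "⇒" for the reversed reading;
companion of the tree's MSB-first `isAutomaticSeq_dfaoSeq`). -/
theorem automaticFamily_isAutomaticSeq_foldl {σ : Type*} [Finite σ] {k : ℕ} (hk : 2 ≤ k)
    (δ : σ → ℕ → σ) (q₀ : σ) (τ : σ → ℂ) :
    IsAutomaticSeq k (fun n => τ ((Nat.digits k n).foldl δ q₀)) := by
  have hk1 : 1 < k := hk
  -- parametrisation of the kernel by (state after the padded digits of `r`, value at `r`)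
  let F : σ × ℂ → (ℕ → ℂ) := fun p n => if n = 0 then p.2 else τ ((Nat.digits k n).foldl δ p.1)
  have hfin : (F '' (Set.univ ×ˢ Set.range τ)).Finite :=
    ((Set.finite_univ).prod (Set.finite_range τ)).image F
  refine hfin.subset ?_
  rintro g ⟨i, -, r, hr, rfl⟩
  refine ⟨((Nat.digitsAppend k i r).foldl δ q₀, τ ((Nat.digits k r).foldl δ q₀)),
    ⟨Set.mem_univ _, ⟨_, rfl⟩⟩, ?_⟩
  funext n
  simp only [F]
  split_ifs with hn
  · simp [hn]
  · rw [add_comm (k ^ i * n) r, digits_add_pow_mul hk1 hr (Nat.pos_of_ne_zero hn),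
      List.foldl_append]

/-- Transition maps that agree on the digits `< k` drive every word over `{0, …, k − 1}` to the
same state. -/
theorem automaticFamily_foldl_congr {σ : Type*} {k : ℕ} {δ δ' : σ → ℕ → σ}
    (h : ∀ q : σ, ∀ d : ℕ, d < k → δ q d = δ' q d) :
    ∀ l : List ℕ, (∀ d ∈ l, d < k) → ∀ q : σ, l.foldl δ q = l.foldl δ' q := by
  intro l
  induction l with
  | nil => intro _ q; rfl
  | cons d l ih =>
    intro hl q
    rw [List.foldl_cons, List.foldl_cons, h q d (hl d (by simp))]
    exact ih (fun x hx => hl x (by simp [hx])) _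

/-- Passage between the real and the complex form of a `λ`-correlation sum with a real weight `b`
(embedded in `ℂ`): `|∑_{m ≤ N} λ(m) b(m)| = ‖∑_{n ≤ N} b(n) λ(n)‖`. -/
theorem automaticFamily_abs_sum_eq_norm (b : ℕ → ℝ) (N : ℕ) :
    |∑ m ∈ Finset.range (N + 1), (ArithmeticFunction.liouville m : ℝ) * b m| =
      ‖∑ n ∈ Finset.range (N + 1), ((b n : ℝ) : ℂ) * (ArithmeticFunction.liouville n : ℂ)‖ := by
  have h : ∑ n ∈ Finset.range (N + 1), ((b n : ℝ) : ℂ) * (ArithmeticFunction.liouville n : ℂ) =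
      ((∑ m ∈ Finset.range (N + 1), (ArithmeticFunction.liouville m : ℝ) * b m : ℝ) : ℂ) := by
    rw [Complex.ofReal_sum]
    refine Finset.sum_congr rfl fun n _ => ?_
    rw [Complex.ofReal_mul, Complex.ofReal_intCast, mul_comm]
  rw [h, Complex.norm_real, Real.norm_eq_abs]

/-- Müllner's theorem for `λ` against ONE real sequence `b` whose complexification is
`2`-automatic: `|∑_{m ≤ N} λ(m) b(m)| ≤ ε N` for all `N ≥ N₀` (the tree's
`MobiusLadder.liouville_automatic_of_mullner` at `k = 2`, in real form). -/
theorem automaticFamily_bound (hM : mullner_moebius_automatic) {b : ℕ → ℝ}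
    (hb : IsAutomaticSeq 2 (fun n => ((b n : ℝ) : ℂ))) {ε : ℝ} (hε : 0 < ε) :
    ∃ N₀ : ℕ, ∀ N : ℕ, N₀ ≤ N →
      |∑ m ∈ Finset.range (N + 1), (ArithmeticFunction.liouville m : ℝ) * b m| ≤ ε * N := by
  obtain ⟨N₀, hN₀⟩ := liouville_automatic_of_mullner hM 2 le_rfl _ hb ε hε
  refine ⟨N₀, fun N hN => ?_⟩
  rw [automaticFamily_abs_sum_eq_norm]
  exact hN₀ N hN

/-- **Stub `stub_automaticFamily` (line `Sketch`, v9, A1) — `λ` is orthogonal to every `S`-state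
automaton scanning the binary digits, uniformly in the automaton.** Assuming the named fact
`mullner_moebius_automatic` (Müllner 2017, Thm. 1.2), for every `S` and `ε > 0` there is `N₀`
such that for all `N ≥ N₀` and ALL `(δ, q₀, τ)` — transition map `δ : Fin S → ℕ → Fin S`, start
`q₀ : Fin S`, output `τ : Fin S → Bool` — both `|∑_{m ≤ N} λ(m) sgn τ(δ*(q₀, (m)₂ MSB-first))|`
and `|∑_{m ≤ N} λ(m) sgn τ(δ*(q₀, (m)₂ LSB-first))|` are `≤ ε N`. Each sequence is `2`-automatic
(`isAutomaticSeq_dfaoSeq`, `automaticFamily_isAutomaticSeq_foldl`), so the `λ`-form of Müllner's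
theorem (`MobiusLadder.liouville_automatic_of_mullner`) applies (`automaticFamily_bound`); the
state depends on `δ` only through its finite binary table (`automaticFamily_foldl_congr`, the
digits being `< 2`), so the thresholds range over the finite type
`(Fin S → Fin 2 → Fin S) × Fin S × (Fin S → Bool)` and `N₀` is a common upper bound
(`Finite.exists_le`). -/
theorem stub_automaticFamily (hM : Literature.NumberTheory.LFunctions.mullner_moebius_automatic)
    (S : ℕ) (ε : ℝ) (hε : 0 < ε) :
    ∃ N₀ : ℕ, ∀ N : ℕ, N₀ ≤ N → ∀ (δ : Fin S → ℕ → Fin S) (q₀ : Fin S) (τ : Fin S → Bool),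
      |∑ m ∈ Finset.range (N + 1), (ArithmeticFunction.liouville m : ℝ) *
          sgn (τ ((Nat.digits 2 m).reverse.foldl δ q₀))| ≤ ε * N ∧
      |∑ m ∈ Finset.range (N + 1), (ArithmeticFunction.liouville m : ℝ) *
          sgn (τ ((Nat.digits 2 m).foldl δ q₀))| ≤ ε * N := by
  -- extension of a binary transition table `e : Fin S → Fin 2 → Fin S` to all of `ℕ`
  let lift : (Fin S → Fin 2 → Fin S) → Fin S → ℕ → Fin S :=
    fun e q d => e q ⟨d % 2, Nat.mod_lt d two_pos⟩
  -- Müllner's theorem for each member of the family, in both reading directions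
  have hMSB : ∀ (e : Fin S → Fin 2 → Fin S) (q₀ : Fin S) (τ : Fin S → Bool), ∃ N₁ : ℕ,
      ∀ N : ℕ, N₁ ≤ N →
        |∑ m ∈ Finset.range (N + 1), (ArithmeticFunction.liouville m : ℝ) *
            sgn (τ ((Nat.digits 2 m).reverse.foldl (lift e) q₀))| ≤ ε * N := by
    intro e q₀ τ
    have ha : IsAutomaticSeq 2
        (fun n => ((sgn (τ ((Nat.digits 2 n).reverse.foldl (lift e) q₀)) : ℝ) : ℂ)) :=
      isAutomaticSeq_dfaoSeq (le_refl 2) (lift e) q₀ (fun q => ((sgn (τ q) : ℝ) : ℂ))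
    exact automaticFamily_bound hM ha hε
  have hLSB : ∀ (e : Fin S → Fin 2 → Fin S) (q₀ : Fin S) (τ : Fin S → Bool), ∃ N₂ : ℕ,
      ∀ N : ℕ, N₂ ≤ N →
        |∑ m ∈ Finset.range (N + 1), (ArithmeticFunction.liouville m : ℝ) *
            sgn (τ ((Nat.digits 2 m).foldl (lift e) q₀))| ≤ ε * N := by
    intro e q₀ τ
    have ha : IsAutomaticSeq 2
        (fun n => ((sgn (τ ((Nat.digits 2 n).foldl (lift e) q₀)) : ℝ) : ℂ)) :=
      automaticFamily_isAutomaticSeq_foldl (le_refl 2) (lift e) q₀ (fun q => ((sgn (τ q) : ℝ) : ℂ))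
    exact automaticFamily_bound hM ha hε
  choose N₁ hN₁ using hMSB
  choose N₂ hN₂ using hLSB
  -- a common threshold over the finite family of binary tables, starts and outputs
  obtain ⟨M₁, hM₁⟩ := Finite.exists_le
    (fun p : (Fin S → Fin 2 → Fin S) × Fin S × (Fin S → Bool) => N₁ p.1 p.2.1 p.2.2)
  obtain ⟨M₂, hM₂⟩ := Finite.exists_le
    (fun p : (Fin S → Fin 2 → Fin S) × Fin S × (Fin S → Bool) => N₂ p.1 p.2.1 p.2.2)
  refine ⟨max M₁ M₂, fun N hN δ q₀ τ => ?_⟩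
  -- `δ` acts on binary words exactly as the extension of its binary table `e`
  let e : Fin S → Fin 2 → Fin S := fun q b => δ q b.val
  have hδ : ∀ q : Fin S, ∀ d : ℕ, d < 2 → δ q d = lift e q d := by
    intro q d hd
    show δ q d = δ q (d % 2)
    rw [Nat.mod_eq_of_lt hd]
  have hdig : ∀ m : ℕ, ∀ d ∈ Nat.digits 2 m, d < 2 := fun m d hd =>
    Nat.digits_lt_base one_lt_two hd
  have hrev : ∀ m : ℕ, (Nat.digits 2 m).reverse.foldl δ q₀ =
      (Nat.digits 2 m).reverse.foldl (lift e) q₀ := fun m =>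
    automaticFamily_foldl_congr hδ _ (fun d hd => hdig m d (List.mem_reverse.mp hd)) q₀
  have hfwd : ∀ m : ℕ, (Nat.digits 2 m).foldl δ q₀ = (Nat.digits 2 m).foldl (lift e) q₀ :=
    fun m => automaticFamily_foldl_congr hδ _ (hdig m) q₀
  have h1 : N₁ e q₀ τ ≤ N := le_trans (le_trans (hM₁ (e, q₀, τ)) (le_max_left _ _)) hN
  have h2 : N₂ e q₀ τ ≤ N := le_trans (le_trans (hM₂ (e, q₀, τ)) (le_max_right _ _)) hN
  have hsum1 : ∑ m ∈ Finset.range (N + 1), (ArithmeticFunction.liouville m : ℝ) *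
        sgn (τ ((Nat.digits 2 m).reverse.foldl δ q₀)) =
      ∑ m ∈ Finset.range (N + 1), (ArithmeticFunction.liouville m : ℝ) *
        sgn (τ ((Nat.digits 2 m).reverse.foldl (lift e) q₀)) :=
    Finset.sum_congr rfl fun m _ => by rw [hrev m]
  have hsum2 : ∑ m ∈ Finset.range (N + 1), (ArithmeticFunction.liouville m : ℝ) *
        sgn (τ ((Nat.digits 2 m).foldl δ q₀)) =
      ∑ m ∈ Finset.range (N + 1), (ArithmeticFunction.liouville m : ℝ) *
        sgn (τ ((Nat.digits 2 m).foldl (lift e) q₀)) :=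
    Finset.sum_congr rfl fun m _ => by rw [hfwd m]
  refine ⟨?_, ?_⟩
  · rw [hsum1]
    exact hN₁ e q₀ τ N h1
  · rw [hsum2]
    exact hN₂ e q₀ τ N h2

end Summit.QuantumAdvantage.QuantumAdvantage.Theorems.LiouvilleOrthogonalTC0

end
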